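import Summits.Ventures.PercRepro.ProfileGapMonoTop
import Summits.Ventures.PercRepro.ProfileThreeMinors

/-!
# PercRepro — THE COLOOP IDENTITY FOR EVERY `q`: at a coloop `z`, `(GM)_q` is the co-rank-`q` row of `M ∖ z`
one level down plus one explicit local inequality `(★_q)` (p5, gen 21; `proofs/P5-GM1.md` §11; announced INBOX 10038)

At a coloop `z` (`ρ(E ∖ z) + 1 = ρ(E)`), with `N := M ∖ z`: the rank-`q` sets of `M` avoiding `z` are those of `N`,
their complement in `M` has rank one more than in `N` (Pascal: the demand at level `u` in `M` is the demand of `N` at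
levels `u` and `u − 1` plus `C(u−1, q−1)` when the complement has `N`-rank exactly `u − 1`); the rank-`q` sets
through `z` are `insert z` of the rank-`(q−1)` sets of `N` and demand `[u ≤ m']·C(m', u−q)`; the co-rank-`q`
rank-`u` sets of `M` are `insert z` of the co-rank-`q` rank-`(u−1)` sets of `N`, the co-rank-`q` rank-`u` sets of
`N`, and the LOST rank-`u` sets of `N` of co-rank exactly `q − 1`.  Hence
`GapMonoQ M z q u ⟸ ProfileIneqMinusQ N q (u−1) ∧ StarQ M z q u`, where `StarQ` is the inequality
`C(u−1,q−1)·#{B ∈ R_q(N) : ρ_N(E'∖B) = u−1} + Σ_{B' ∈ R_{q−1}(N), u ≤ ρ_N(E'∖B')} C(ρ_N(E'∖B'), u−q)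
  ≤ C(u−1,q−1)·#levelSetCoQ N q (u−1) + C(u,q)·#{S : ρ_N(S) = u, ρ_N(E'∖S) = q−1}`.
`(★_1)` is the `q = 1` coloop case (tree, p10); `(★_2)`, `(★_3)` hold on every example tested and are the open local
inequality at coloops.

* `rk_insert_coloop` — `ρ(X ∪ z) = ρ(X) + 1` for `X ⊆ E ∖ z`;
* `sum_demand_coloop` — the demand identity; `card_levelSetCoQ_coloop` — the supply identity;
* `StarQ`, **`gapMonoQ_of_coloop_of_starQ`**.
-/

open scoped Matroid

namespace PercRepro.Cogirth

open Finset ThmH Skew Shadow Profile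

variable {α : Type} [DecidableEq α] {M : Matroid α} [M.Finite]

/-- `ρ(X ∪ e) = ρ(X)` when `e ∈ cl X`. -/
theorem rk_insert_eq_of_mem_closure_cq {e : α} {X : Finset α} (h : e ∈ M.closure (X : Set α)) :
    rk M (insert e X) = rk M X := by
  unfold rk
  rw [Finset.coe_insert, ← M.eRk_closure_eq (insert e (X : Set α)),
    Matroid.closure_insert_eq_of_mem_closure h, M.eRk_closure_eq]

/-- `ρ(X ∪ e) = ρ(X) + 1` when `e ∈ E ∖ cl X`. -/
theorem rk_insert_eq_succ_of_notMem_closure_cq {e : α} (he : e ∈ gr M) {X : Finset α}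
    (h : e ∉ M.closure (X : Set α)) : rk M (insert e X) = rk M X + 1 := by
  have heE : e ∈ M.E := by rw [← coe_gr]; exact_mod_cast he
  have h1 := M.eRk_insert_eq_add_one (X := (X : Set α)) ⟨heE, h⟩
  rw [← Finset.coe_insert, ← coe_rk, ← coe_rk] at h1
  exact_mod_cast h1

omit [DecidableEq α] in
/-- `ρ` from `eRk`. -/
theorem rk_eq_of_eRk_eq_cq {S : Finset α} {u : ℕ} (h : M.eRk (S : Set α) = (u : ℕ∞)) : rk M S = u := by
  unfold rk; rw [h]; exact ENat.toNat_coe u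

omit [DecidableEq α] in
/-- `eRk` from `ρ`. -/
theorem eRk_eq_of_rk_eq_cq {S : Finset α} {u : ℕ} (h : rk M S = u) : M.eRk (S : Set α) = (u : ℕ∞) := by
  rw [← coe_rk, h]

section Coloop

variable {z : α} {q u : ℕ} (hz : z ∈ gr M) (hzc : rk M ((gr M).erase z) + 1 = rk M (gr M))

include hz hzc in
/-- At a coloop `z`: `ρ(X ∪ z) = ρ(X) + 1` for every `X ⊆ E ∖ z`. -/
theorem rk_insert_coloop {X : Finset α} (hX : X ⊆ (gr M).erase z) : rk M (insert z X) = rk M X + 1 := by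
  apply rk_insert_eq_succ_of_notMem_closure_cq hz
  intro hcl
  have h2 : z ∈ M.closure (((gr M).erase z : Finset α) : Set α) :=
    M.closure_subset_closure (by exact_mod_cast hX) hcl
  have h3 := rk_insert_eq_of_mem_closure_cq h2
  rw [insert_erase hz] at h3
  omega

include hz hzc in
/-- The rank-`q` sets through a coloop `z` are `insert z` of the rank-`(q−1)` sets of `M ∖ z` (`1 ≤ q`). -/
theorem Rq_filter_mem_eq_image_delete (hq : 1 ≤ q) :
    (Rq M q).filter (fun B => z ∈ B) = (Rq (M ＼ ({z} : Set α)) (q - 1)).image (insert z) := by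
  ext B
  rw [mem_filter, mem_image]
  constructor
  · rintro ⟨hB, hzB⟩
    refine ⟨B.erase z, ?_, insert_erase hzB⟩
    rw [mem_Rq] at hB ⊢
    obtain ⟨hBg, hBr⟩ := hB
    have hsub : B.erase z ⊆ (gr M).erase z := erase_subset_erase z hBg
    have h := rk_insert_coloop hz hzc hsub
    rw [insert_erase hzB] at h
    have hBq : rk M B = q := rk_eq_of_eRk_eq_cq hBr
    refine ⟨by rw [gr_delete']; exact hsub, ?_⟩
    rw [← coe_rk, rk_delete hsub]
    have : rk M (B.erase z) = q - 1 := by omega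
    rw [this]
  · rintro ⟨B', hB', rfl⟩
    rw [mem_Rq] at hB'
    obtain ⟨hBg, hBr⟩ := hB'
    rw [gr_delete'] at hBg
    have hBq : rk (M ＼ ({z} : Set α)) B' = q - 1 := rk_eq_of_eRk_eq_cq hBr
    rw [rk_delete hBg] at hBq
    refine ⟨?_, mem_insert_self z B'⟩
    rw [mem_Rq]
    refine ⟨insert_subset hz (subset_erase.1 hBg).1, ?_⟩
    rw [← coe_rk, rk_insert_coloop hz hzc hBg]
    have : rk M B' + 1 = q := by omega
    rw [this]

include hz hzc in
/-- The demand in `M` of a rank-`q` set `B ∌ z`, from `M ∖ z`: with `m := ρ_N(E' ∖ B)`,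
`[u ≤ m+1]·C(m+1, u−q) = demand_N(u) + demand_N(u−1) + [m = u−1]·C(u−1, q−1)` (`1 ≤ q < u`). -/
theorem demand_of_notMem_coloop (hq : 1 ≤ q) (hqu : q < u) {B : Finset α} (hB : B ∈ Rq (M ＼ ({z} : Set α)) q) :
    demand M q u B = demand (M ＼ ({z} : Set α)) q u B + demand (M ＼ ({z} : Set α)) q (u - 1) B +
      (if rk (M ＼ ({z} : Set α)) (gr (M ＼ ({z} : Set α)) \ B) = u - 1 then (u - 1).choose (q - 1) else 0) := by
  rw [mem_Rq, gr_delete'] at hB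
  obtain ⟨hBg, _⟩ := hB
  have hzB : z ∉ B := fun h => (mem_erase.1 (hBg h)).1 rfl
  have hsub : (gr M).erase z \ B ⊆ (gr M).erase z := sdiff_subset
  have hins : insert z ((gr M).erase z \ B) = gr M \ B := by
    rw [erase_sdiff, insert_erase (mem_sdiff.2 ⟨hz, hzB⟩)]
  have hrk : rk M (gr M \ B) = rk M ((gr M).erase z \ B) + 1 := by
    rw [← hins, rk_insert_coloop hz hzc hsub]
  unfold demand
  rw [gr_delete', rk_delete hsub, hrk]
  set m := rk M ((gr M).erase z \ B) with hm
  obtain ⟨k, hk⟩ : ∃ k, u - q = k + 1 := ⟨u - q - 1, by omega⟩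
  have hk' : u - 1 - q = k := by omega
  rw [hk, hk']
  rcases Nat.lt_or_ge m (u - 1) with hlt | hge
  · rw [if_neg (by omega), if_neg (by omega), if_neg (by omega), if_neg (by omega)]
  · rcases Nat.eq_or_lt_of_le hge with heq | hgt
    · rw [if_pos (by omega), if_neg (by omega), if_pos (by omega), if_pos heq.symm]
      rw [← heq, Nat.choose_succ_succ]
      have h1 : u - 1 = q + k := by omega
      have h2 : (u - 1).choose (k + 1) = (u - 1).choose (q - 1) := by
        rw [← Nat.choose_symm (by omega : k + 1 ≤ u - 1)]
        congr 1; omega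
      rw [h2]; ring
    · rw [if_pos (by omega), if_pos (by omega), if_pos (by omega), if_neg (by omega), Nat.choose_succ_succ]
      ring

/-- The demand in `M` of `insert z B'` for a rank-`(q−1)` set `B'` of `M ∖ z`: `[u ≤ m']·C(m', u−q)`,
`m' := ρ_N(E' ∖ B')`. -/
theorem demand_insert_coloop {B' : Finset α} (hB' : B' ∈ Rq (M ＼ ({z} : Set α)) (q - 1)) :
    demand M q u (insert z B') =
      if u ≤ rk (M ＼ ({z} : Set α)) (gr (M ＼ ({z} : Set α)) \ B') then
        (rk (M ＼ ({z} : Set α)) (gr (M ＼ ({z} : Set α)) \ B')).choose (u - q) else 0 := by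
  rw [mem_Rq, gr_delete'] at hB'
  obtain ⟨hBg, _⟩ := hB'
  have hcomp : gr M \ insert z B' = (gr M).erase z \ B' := by rw [sdiff_insert, erase_sdiff]
  unfold demand
  rw [hcomp, gr_delete', rk_delete sdiff_subset]

include hz hzc in
/-- **The demand identity at a coloop.** -/
theorem sum_demand_coloop (hq : 1 ≤ q) (hqu : q < u) :
    ∑ B ∈ Rq M q, demand M q u B =
      ∑ B ∈ Rq (M ＼ ({z} : Set α)) q, demand (M ＼ ({z} : Set α)) q u B +
        ∑ B ∈ Rq (M ＼ ({z} : Set α)) q, demand (M ＼ ({z} : Set α)) q (u - 1) B +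
        (u - 1).choose (q - 1) *
          ((Rq (M ＼ ({z} : Set α)) q).filter
            (fun B => rk (M ＼ ({z} : Set α)) (gr (M ＼ ({z} : Set α)) \ B) = u - 1)).card +
        ∑ B' ∈ Rq (M ＼ ({z} : Set α)) (q - 1),
          (if u ≤ rk (M ＼ ({z} : Set α)) (gr (M ＼ ({z} : Set α)) \ B') then
            (rk (M ＼ ({z} : Set α)) (gr (M ＼ ({z} : Set α)) \ B')).choose (u - q) else 0) := by
  rw [← sum_filter_add_sum_filter_not (Rq M q) (fun B => z ∈ B) (demand M q u), add_comm,
    Rq_filter_mem_eq_image_delete hz hzc hq]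
  have hinj : Set.InjOn (insert z) ((Rq (M ＼ ({z} : Set α)) (q - 1) : Finset (Finset α)) : Set (Finset α)) := by
    intro B hB B' hB' h
    rw [mem_coe, mem_Rq, gr_delete'] at hB hB'
    have h1 : z ∉ B := fun hzB => (mem_erase.1 (hB.1 hzB)).1 rfl
    have h2 : z ∉ B' := fun hzB => (mem_erase.1 (hB'.1 hzB)).1 rfl
    rw [← erase_insert h1, ← erase_insert h2, h]
  rw [sum_image hinj, ← Rq_delete_eq_filter]
  have hsplit : ∑ B ∈ Rq (M ＼ ({z} : Set α)) q, demand M q u B =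
      ∑ B ∈ Rq (M ＼ ({z} : Set α)) q, (demand (M ＼ ({z} : Set α)) q u B +
        demand (M ＼ ({z} : Set α)) q (u - 1) B +
        (if rk (M ＼ ({z} : Set α)) (gr (M ＼ ({z} : Set α)) \ B) = u - 1 then (u - 1).choose (q - 1) else 0)) :=
    sum_congr rfl (fun B hB => demand_of_notMem_coloop hz hzc hq hqu hB)
  rw [hsplit, sum_add_distrib, sum_add_distrib, sum_ite, sum_const_zero, add_zero, sum_const, smul_eq_mul,
    mul_comm]
  congr 1
  exact sum_congr rfl (fun B' hB' => demand_insert_coloop hB')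

/-- The LOST sets of `M ∖ z`: rank-`u` sets whose complement has rank exactly `q − 1`. -/
noncomputable def lostSets (N : Matroid α) [N.Finite] (q u : ℕ) : Finset (Finset α) :=
  (levelSet N u).filter (fun S => rk N (gr N \ S) = q - 1)

/-- The complement of a set through `z`, in `E ∖ z`. -/
theorem erase_sdiff_erase_of_mem {z : α} {S : Finset α} (hzS : z ∈ S) :
    (gr M).erase z \ S.erase z = gr M \ S := by
  ext x
  simp only [mem_sdiff, mem_erase, not_and]
  constructor
  · rintro ⟨⟨hxz, hxE⟩, hx⟩
    exact ⟨hxE, fun hxS => hx hxz hxS⟩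
  · rintro ⟨hxE, hxS⟩
    exact ⟨⟨fun h => hxS (h ▸ hzS), hxE⟩, fun _ hxS' => hxS hxS'⟩

include hz hzc in
/-- The co-rank-`q` rank-`u` sets of `M` through the coloop `z` are `insert z` of the co-rank-`q` rank-`(u−1)`
sets of `M ∖ z` (`1 ≤ u`). -/
theorem levelSetCoQ_filter_mem_eq_image_delete (hu : 1 ≤ u) :
    (levelSetCoQ M q u).filter (fun S => z ∈ S) = (levelSetCoQ (M ＼ ({z} : Set α)) q (u - 1)).image (insert z) := by
  ext S
  rw [mem_filter, mem_image]
  constructor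
  · rintro ⟨hS, hzS⟩
    refine ⟨S.erase z, ?_, insert_erase hzS⟩
    rw [mem_levelSetCoQ] at hS ⊢
    obtain ⟨⟨hSg, hSr⟩, hSc⟩ := hS
    have hsub : S.erase z ⊆ (gr M).erase z := erase_subset_erase z hSg
    have h := rk_insert_coloop hz hzc hsub
    rw [insert_erase hzS] at h
    have hSu : rk M S = u := rk_eq_of_eRk_eq_cq hSr
    have hcsub : gr M \ S ⊆ (gr M).erase z := fun x hx => mem_erase.2 ⟨fun h' => (mem_sdiff.1 hx).2 (h' ▸ hzS), (mem_sdiff.1 hx).1⟩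
    refine ⟨⟨by rw [gr_delete']; exact hsub, ?_⟩, ?_⟩
    · rw [← coe_rk, rk_delete hsub]
      have : rk M (S.erase z) = u - 1 := by omega
      rw [this]
    · rw [gr_delete', erase_sdiff_erase_of_mem hzS, rk_delete hcsub]; exact hSc
  · rintro ⟨S', hS', rfl⟩
    rw [mem_levelSetCoQ, gr_delete'] at hS'
    obtain ⟨⟨hSg, hSr⟩, hSc⟩ := hS'
    have hzS' : z ∉ S' := fun h => (mem_erase.1 (hSg h)).1 rfl
    have hSr' : rk (M ＼ ({z} : Set α)) S' = u - 1 := rk_eq_of_eRk_eq_cq hSr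
    rw [rk_delete hSg] at hSr'
    have hcomp : gr M \ insert z S' = (gr M).erase z \ S' := by rw [sdiff_insert, erase_sdiff]
    refine ⟨?_, mem_insert_self z S'⟩
    rw [mem_levelSetCoQ]
    refine ⟨⟨insert_subset hz (subset_erase.1 hSg).1, ?_⟩, ?_⟩
    · rw [← coe_rk, rk_insert_coloop hz hzc hSg]
      have : rk M S' + 1 = u := by omega
      rw [this]
    · rw [hcomp, ← rk_delete (sdiff_subset : (gr M).erase z \ S' ⊆ (gr M).erase z)]; exact hSc

include hz hzc in
/-- The co-rank-`q` rank-`u` sets of `M` avoiding the coloop `z`: the co-rank-`q` ones of `M ∖ z` and the LOST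
ones (`1 ≤ q`). -/
theorem levelSetCoQ_filter_notMem_eq_delete (hq : 1 ≤ q) :
    (levelSetCoQ M q u).filter (fun S => z ∉ S) =
      levelSetCoQ (M ＼ ({z} : Set α)) q u ∪ lostSets (M ＼ ({z} : Set α)) q u := by
  ext S
  rw [mem_filter, mem_union, mem_levelSetCoQ, mem_levelSetCoQ]
  unfold lostSets
  rw [mem_filter, mem_levelSet, gr_delete']
  constructor
  · rintro ⟨⟨⟨hSg, hSr⟩, hSc⟩, hzS⟩
    have hsub : S ⊆ (gr M).erase z := subset_erase.2 ⟨hSg, hzS⟩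
    have hins : insert z ((gr M).erase z \ S) = gr M \ S := by
      rw [erase_sdiff, insert_erase (mem_sdiff.2 ⟨hz, hzS⟩)]
    have hrk : rk M (gr M \ S) = rk M ((gr M).erase z \ S) + 1 := by
      rw [← hins, rk_insert_coloop hz hzc sdiff_subset]
    have hSr' : (M ＼ ({z} : Set α)).eRk (S : Set α) = (u : ℕ∞) := by
      rw [← coe_rk, rk_delete hsub, coe_rk]; exact hSr
    rw [rk_delete (sdiff_subset : (gr M).erase z \ S ⊆ (gr M).erase z)]
    rcases Nat.lt_or_ge (rk M ((gr M).erase z \ S)) q with hlt | hge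
    · right; exact ⟨⟨hsub, hSr'⟩, by omega⟩
    · left; exact ⟨⟨hsub, hSr'⟩, hge⟩
  · intro h
    have key : S ⊆ (gr M).erase z ∧ (M ＼ ({z} : Set α)).eRk (S : Set α) = (u : ℕ∞) ∧
        q - 1 ≤ rk (M ＼ ({z} : Set α)) ((gr M).erase z \ S) := by
      rcases h with ⟨⟨hSg, hSr⟩, hSc⟩ | ⟨⟨hSg, hSr⟩, hSc⟩
      · exact ⟨hSg, hSr, by omega⟩
      · exact ⟨hSg, hSr, by omega⟩
    obtain ⟨hsub, hSr', hSc'⟩ := key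
    have hzS : z ∉ S := fun h' => (mem_erase.1 (hsub h')).1 rfl
    have hins : insert z ((gr M).erase z \ S) = gr M \ S := by
      rw [erase_sdiff, insert_erase (mem_sdiff.2 ⟨hz, hzS⟩)]
    have hrk : rk M (gr M \ S) = rk M ((gr M).erase z \ S) + 1 := by
      rw [← hins, rk_insert_coloop hz hzc sdiff_subset]
    rw [rk_delete (sdiff_subset : (gr M).erase z \ S ⊆ (gr M).erase z)] at hSc'
    refine ⟨⟨⟨(subset_erase.1 hsub).1, ?_⟩, by omega⟩, hzS⟩
    rw [← coe_rk, ← rk_delete hsub, coe_rk]; exact hSr'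

include hz hzc in
/-- **The supply identity at a coloop**: `W⁻_q(M;u) = W⁻_q(N;u−1) + W⁻_q(N;u) + #LOST`. -/
theorem card_levelSetCoQ_coloop (hq : 1 ≤ q) (hu : 1 ≤ u) :
    (levelSetCoQ M q u).card =
      (levelSetCoQ (M ＼ ({z} : Set α)) q (u - 1)).card + (levelSetCoQ (M ＼ ({z} : Set α)) q u).card +
        (lostSets (M ＼ ({z} : Set α)) q u).card := by
  rw [← card_filter_add_card_filter_not (fun S => z ∈ S) (s := levelSetCoQ M q u),
    levelSetCoQ_filter_mem_eq_image_delete hz hzc hu, levelSetCoQ_filter_notMem_eq_delete hz hzc hq,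
    card_image_of_injOn (fun S hS S' hS' h => by
      rw [mem_coe, mem_levelSetCoQ, gr_delete'] at hS hS'
      have h1 : z ∉ S := fun hzS => (mem_erase.1 (hS.1.1 hzS)).1 rfl
      have h2 : z ∉ S' := fun hzS => (mem_erase.1 (hS'.1.1 hzS)).1 rfl
      rw [← erase_insert h1, ← erase_insert h2, h]),
    card_union_of_disjoint (by
      rw [disjoint_left]
      intro S hS hS'
      rw [mem_levelSetCoQ] at hS
      unfold lostSets at hS'
      rw [mem_filter] at hS'
      omega)]
  ring

/-- **`(★_q)` at a coloop** (the open local inequality for `q ≥ 2`; `(★_1)` is the `q = 1` coloop case). -/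
def StarQ (M : Matroid α) [M.Finite] (z : α) (q u : ℕ) : Prop :=
  (u - 1).choose (q - 1) *
      ((Rq (M ＼ ({z} : Set α)) q).filter
        (fun B => rk (M ＼ ({z} : Set α)) (gr (M ＼ ({z} : Set α)) \ B) = u - 1)).card +
    ∑ B' ∈ Rq (M ＼ ({z} : Set α)) (q - 1),
      (if u ≤ rk (M ＼ ({z} : Set α)) (gr (M ＼ ({z} : Set α)) \ B') then
        (rk (M ＼ ({z} : Set α)) (gr (M ＼ ({z} : Set α)) \ B')).choose (u - q) else 0) ≤
  (u - 1).choose (q - 1) * (levelSetCoQ (M ＼ ({z} : Set α)) q (u - 1)).card +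
    u.choose q * (lostSets (M ＼ ({z} : Set α)) q u).card

include hz hzc in
/-- **THE COLOOP IDENTITY, AS A THEOREM**: at a coloop `z`, the co-rank-`q` row of `M ∖ z` at level `u − 1`
together with `(★_q)` gives `(GM)_q` at `z`. -/
theorem gapMonoQ_of_coloop_of_starQ (hq : 1 ≤ q) (hqu : q < u)
    (h : ProfileIneqMinusQ (M ＼ ({z} : Set α)) q (u - 1)) (hstar : StarQ M z q u) : GapMonoQ M z q u := by
  unfold GapMonoQ
  rw [sum_demand_coloop hz hzc hq hqu, card_levelSetCoQ_coloop hz hzc hq (by omega)]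
  unfold ProfileIneqMinusQ at h
  unfold StarQ at hstar
  have hC : u.choose q = (u - 1).choose q + (u - 1).choose (q - 1) := by
    obtain ⟨u', rfl⟩ : ∃ u', u = u' + 1 := ⟨u - 1, by omega⟩
    obtain ⟨q', rfl⟩ : ∃ q', q = q' + 1 := ⟨q - 1, by omega⟩
    simp only [Nat.add_sub_cancel]
    rw [Nat.choose_succ_succ, Nat.add_comm]
  set N := M ＼ ({z} : Set α)
  set Du := ∑ B ∈ Rq N q, demand N q u B
  set Dm := ∑ B ∈ Rq N q, demand N q (u - 1) B
  set F := ((Rq N q).filter (fun B => rk N (gr N \ B) = u - 1)).card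
  set T := ∑ B' ∈ Rq N (q - 1), (if u ≤ rk N (gr N \ B') then (rk N (gr N \ B')).choose (u - q) else 0)
  set Wm := (levelSetCoQ N q (u - 1)).card
  set Wu := (levelSetCoQ N q u).card
  set L := (lostSets N q u).card
  rw [hC]
  -- goal: Du + Dm + C(u−1,q−1)·F + T + (C(u−1,q) + C(u−1,q−1))·Wu ≤ Du + (C(u−1,q) + C(u−1,q−1))·(Wm + Wu + L)
  nlinarith [h, hstar, Nat.zero_le Wm, Nat.zero_le L, Nat.zero_le ((u - 1).choose q)]

end Coloop

end PercRepro.Cogirth
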